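import Literature.NumberTheory.Sieve.DrappeauDispersionS3
import HarnessLib

/-!
# Drappeau 2017, §5.3.2: `𝒮₂` against its main term `α̂(0) X₂`, and `X₂ = X₃` — the algebraic part, proved

S. Drappeau, *Sums of Kloosterman sums in arithmetic progressions, and the error term in the
dispersion method*, Proc. London Math. Soc. (3) 114 (2017) 684–732 = arXiv:1504.05549
(`Drappeau2017`; held as `paper:arxiv-1504.05549`, §5.3.2 read on chunks 18–19).

§5.3.2 of the source evaluates the dispersion sum `𝒮₂` of the proof of **Theorem 5.1**
(`Literature.NumberTheory.Sieve.Drappeau2017_theorem51`; `𝒮₂ = Drappeau2017.dispS2` of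
`…DrappeauDispersionSkeleton`): "(5.17) `𝒮₂ = ∑_{(q₁q₂,a₁a₂)=1} γ(q₁)γ(q₂)/φ(q₂) ∑_{n₁,n₂}
β_{n₁}β̄_{n₂} ∑_{χ₂ ∈ 𝒳_{q₂}(R)} ∑_{m ≡ a₁ā₂n̄₁ (mod q₁)} α(m) χ₂(mn₂ā₁a₂)`.  As before, let
`W = [q₁,q₂]` … By Poisson summation, (5.18) `∑_{m ≡ a₁ā₂n̄₁ (q₁)} α(m)χ₂(m)
= (α̂(0)/W) ∑_{b mod W, (b,W)=1, b ≡ a₁ā₂n̄₁ (q₁)} χ₂(b) + O_ε(ℛ₂ + W^ε)` … We therefore have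
`𝒮₂ = α̂(0)X₂ + O(MN²R⁻²)` with … `X₂ = ∑ γ(q₁)γ(q₂)/([q₁,q₂]φ(q₂)) ∑_{n₁,n₂} β_{n₁}β̄_{n₂}
∑_{χ₂ ∈ 𝒳_{q₂}(R)} χ₂(n₂) ∑_{b mod W,(b,W)=1, b ≡ n̄₁ (q₁)} χ₂(b)`. … We therefore find
`∑_{b ≡ n̄₁ (q₁)} χ₂(b) = (φ(q₂)/φ((q₁,q₂))) 1_{q̃₂ ∣ (q₁,q₂)} χ̃₂(n̄₁)`.  Summing over `χ₂ ∈ 𝒳_{q₂}(R)` …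
`∑_{χ₂} χ₂(n₂) ∑_{b ≡ n̄₁ (q₁)} χ₂(b) = (φ(q₂)/φ((q₁,q₂))) ∑_{χ₀ ∈ 𝒳_{(q₁,q₂)}(R)} χ₀(n̄₁n₂)`,
and so `X₂ = X₃`."

This file PROVES everything in this paragraph except the Poisson summation step (5.18) and the
Gauss-sum estimate of `ℛ₂` (the analytic input), in the following form (`nⱼ' = nⱼ ā₁ a₂ mod qⱼ`;
the class sums of characters are in `…DrappeauDispersionOrthogonality`):

* `dispS2_eq_sum_chars` — **(5.17)**:
  `𝒮₂ = ∑_{q₁,q₂} γ(q₁)γ(q₂) φ(q₂)⁻¹ ∑_{χ₂ ∈ 𝒳_{q₂}(R)} ∑_{n₁,n₂} β_{n₁}β̄_{n₂} χ₂(n₂')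
  ∑_{m: m n₁' ≡ 1 (q₁)} w(m) χ₂(m)` (the kernel `K_R` being real, `conj_mainKernel`);
* `mul_mainX3_eq_sum_chars₂` — **`X₂ = X₃`**, i.e. (5.19) and the class-sum identity read
  backwards: for any `A`,
  `A · X₃ = ∑_{q₁,q₂} γ(q₁)γ(q₂) φ(q₂)⁻¹ ∑_{χ₂} ∑_{n₁,n₂} β_{n₁}β̄_{n₂} χ₂(n₂')
  · (A/W) ∑_{0 ≤ b < W, b n₁' ≡ 1 (q₁)} χ₂(b)` (`W = [q₁,q₂]`; the `b`-sum is the printed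
  `∑_{b mod W,(b,W)=1, b ≡ n̄₁' (q₁)} χ₂(b)`), through `sum_twist_mul_sum_units_filter_eq`
  (`∑_{χ₂} χ₂(n₂') ∑_{b ≡ n̄₁' (q₁)} χ₂(b) = (φ(W)/φ(q₁)) ∑_{χ₀ ∈ 𝒳_{(q₁,q₂)}(R)} χ₀(n̄₁ n₂)`: the
  factors `ā₁a₂` cancel), `∑_{χ₀} χ₀(n̄₁n₂) = ∑_{χ₀} χ₀(n₁n̄₂)` (`sum_filter_conductor_apply_inv_eq`)
  and `φ(W)φ((q₁,q₂)) = φ(q₁)φ(q₂)`;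
* `dispS2_sub_mul_mainX3_eq`, `norm_dispS2_sub_mul_mainX3_le` — hence
  `|𝒮₂ − A X₃| ≤ ∑_{q₁,q₂} |γ(q₁)γ(q₂)| φ(q₂)⁻¹ #𝒳_{q₂}(R) (∑_n |β_n|)² · E` whenever
  `|∑_{m: mn₁'≡1 (q₁)} w(m)χ₂(m) − (A/W) ∑_{b<W, bn₁'≡1 (q₁)} χ₂(b)| ≤ E` throughout (the source's
  (5.18) with its bound on `ℛ₂`; not proved here).

## References

* S. Drappeau, Proc. London Math. Soc. (3) 114 (2017) 684–732, arXiv:1504.05549, §5.3.2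
  (5.17)–(5.19). [Drappeau2017]
-/

noncomputable section

open Finset DirichletCharacter

namespace Literature.NumberTheory.Sieve

namespace Drappeau2017

/-! ### Two small identities -/

/-- Sums over `𝒳_q(R)` are stable under `t ↦ t̄` (for a unit `t`): `χ ↦ χ̄` permutes `𝒳_q(R)`.
[cite: Drappeau2017, §5.3.2] -/
theorem sum_filter_conductor_apply_inv_eq (R : ℝ) {q : ℕ} {t : ZMod q} (ht : IsUnit t) :
    ∑ χ ∈ (univ.filter fun χ : DirichletCharacter ℂ q => (χ.conductor : ℝ) ≤ R), χ t⁻¹ =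
      ∑ χ ∈ (univ.filter fun χ : DirichletCharacter ℂ q => (χ.conductor : ℝ) ≤ R), χ t := by
  classical
  rw [Finset.sum_filter, Finset.sum_filter]
  refine Fintype.sum_equiv (Equiv.inv (DirichletCharacter ℂ q)) _ _ fun χ => ?_
  simp only [Equiv.inv_apply, conductor_inv]
  split_ifs
  · rw [apply_inv_of_isUnit χ ht, MulChar.inv_apply_eq_inv']
  · rfl

/-- For units `a, b` of `ZMod d`: `(ā b)⁻¹ = a b̄`. [folklore] -/
theorem inv_inv_mul_eq_mul_inv {d : ℕ} {a b : ZMod d} (ha : IsUnit a) (hb : IsUnit b) :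
    (a⁻¹ * b)⁻¹ = a * b⁻¹ := by
  obtain ⟨u, rfl⟩ := ha
  obtain ⟨v, rfl⟩ := hb
  rw [ZMod.inv_coe_unit u, ← Units.val_mul, ZMod.inv_coe_unit, ZMod.inv_coe_unit v,
    ← Units.val_mul, mul_inv_rev, inv_inv]
  congr 1
  exact mul_comm _ _

/-- For units `a, b` of `ZMod d`, `ā b` is a unit. [folklore] -/
theorem isUnit_inv_mul {d : ℕ} {a b : ZMod d} (ha : IsUnit a) (hb : IsUnit b) :
    IsUnit (a⁻¹ * b) := by
  obtain ⟨u, rfl⟩ := ha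
  obtain ⟨v, rfl⟩ := hb
  rw [ZMod.inv_coe_unit, ← Units.val_mul]
  exact Units.isUnit _

/-! ### (5.17): the `m`-sum of `𝒮₂` -/

/-- The `m`-sum of `𝒮₂` expanded over `𝒳_{q₂}(R)`:
`∑_m w(m) 1[mn₁ā₁a₂ ≡ 1 (q₁)] K̄_R(mn₂ā₁a₂; q₂)
  = φ(q₂)⁻¹ ∑_{χ₂ ∈ 𝒳_{q₂}(R)} χ₂(n₂ā₁a₂) ∑_{m: m n₁ā₁a₂ ≡ 1 (q₁)} w(m) χ₂(m)` (`K_R` is real).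
[cite: Drappeau2017, §5.3.2 (5.17)] -/
theorem sum_mul_ite_mul_conj_mainKernel_eq (R : ℝ) (a₁ a₂ : ℤ) (q₁ q₂ : ℕ) (ℳ : Finset ℕ)
    (w : ℕ → ℝ) (n₁ n₂ : ℕ) :
    ∑ m ∈ ℳ, (w m : ℂ) * (if kerArg a₁ a₂ q₁ m n₁ = 1 then 1 else 0) *
        starRingEnd ℂ (mainKernel R q₂ (kerArg a₁ a₂ q₂ m n₂)) =
      ((Nat.totient q₂ : ℂ))⁻¹ *
        ∑ χ₂ ∈ (univ.filter fun χ : DirichletCharacter ℂ q₂ => (χ.conductor : ℝ) ≤ R),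
          χ₂ ((n₂ : ZMod q₂) * ((a₁ : ZMod q₂))⁻¹ * (a₂ : ZMod q₂)) *
            ∑ m ∈ ℳ, (w m : ℂ) *
              (if (m : ZMod q₁) * ((n₁ : ZMod q₁) * ((a₁ : ZMod q₁))⁻¹ * (a₂ : ZMod q₁)) = 1 then
                χ₂ (m : ZMod q₂) else 0) := by
  have hm : ∀ m : ℕ, (w m : ℂ) * (if kerArg a₁ a₂ q₁ m n₁ = 1 then 1 else 0) *
      starRingEnd ℂ (mainKernel R q₂ (kerArg a₁ a₂ q₂ m n₂)) =
      ((Nat.totient q₂ : ℂ))⁻¹ *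
        ∑ χ₂ ∈ (univ.filter fun χ : DirichletCharacter ℂ q₂ => (χ.conductor : ℝ) ≤ R),
          χ₂ ((n₂ : ZMod q₂) * ((a₁ : ZMod q₂))⁻¹ * (a₂ : ZMod q₂)) *
            ((w m : ℂ) *
              (if (m : ZMod q₁) * ((n₁ : ZMod q₁) * ((a₁ : ZMod q₁))⁻¹ * (a₂ : ZMod q₁)) = 1 then
                χ₂ (m : ZMod q₂) else 0)) := by
    intro m
    rw [conj_mainKernel, mainKernel_eq_inv_mul_sum_filter, kerArg_eq_mul, kerArg_eq_mul]
    by_cases h : (m : ZMod q₁) * ((n₁ : ZMod q₁) * ((a₁ : ZMod q₁))⁻¹ * (a₂ : ZMod q₁)) = 1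
    · simp only [if_pos h, mul_one, Finset.mul_sum]
      refine Finset.sum_congr rfl fun χ₂ _ => ?_
      rw [map_mul]
      ring
    · simp only [if_neg h, mul_zero, zero_mul, Finset.sum_const_zero]
  rw [Finset.sum_congr rfl fun m _ => hm m, ← Finset.mul_sum, Finset.sum_comm]
  congr 1
  refine Finset.sum_congr rfl fun χ₂ _ => ?_
  rw [Finset.mul_sum]

/-- `∑_a ∑_b c(a,b) · K ∑_i F = K ∑_i ∑_a ∑_b c(a,b) F`. [folklore] -/
theorem sum_sum_mul_mul_sum {α β ι : Type*} (A : Finset α) (B : Finset β) (s : Finset ι)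
    (c : α → β → ℂ) (K : ℂ) (F : ι → α → β → ℂ) :
    ∑ a ∈ A, ∑ b ∈ B, c a b * (K * ∑ i ∈ s, F i a b) =
      K * ∑ i ∈ s, ∑ a ∈ A, ∑ b ∈ B, c a b * F i a b := by
  rw [Finset.mul_sum]
  simp only [Finset.mul_sum]
  have h1 : ∀ a ∈ A, ∑ b ∈ B, ∑ i ∈ s, c a b * (K * F i a b) =
      ∑ i ∈ s, ∑ b ∈ B, K * (c a b * F i a b) := by
    intro a _
    rw [Finset.sum_comm]
    exact Finset.sum_congr rfl fun _ _ => Finset.sum_congr rfl fun _ _ => by ring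
  rw [Finset.sum_congr rfl h1]
  exact Finset.sum_comm

/-- **(5.17)**: `𝒮₂ = ∑_{q₁,q₂} γ(q₁)γ(q₂) φ(q₂)⁻¹ ∑_{χ₂ ∈ 𝒳_{q₂}(R)} ∑_{n₁,n₂} β_{n₁}β̄_{n₂}
χ₂(n₂ā₁a₂) ∑_{m: mn₁ā₁a₂ ≡ 1 (q₁)} w(m) χ₂(m)`. [cite: Drappeau2017, §5.3.2 (5.17)] -/
theorem dispS2_eq_sum_chars (R : ℝ) (a₁ a₂ : ℤ) (𝒬 ℳ 𝒩 : Finset ℕ) (γ w : ℕ → ℝ) (β : ℕ → ℂ) :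
    dispS2 R a₁ a₂ 𝒬 ℳ 𝒩 γ w β =
      ∑ q₁ ∈ 𝒬.filter (fun q : ℕ => IsCoprime (q : ℤ) (a₁ * a₂)),
        ∑ q₂ ∈ 𝒬.filter (fun q : ℕ => IsCoprime (q : ℤ) (a₁ * a₂)), (γ q₁ : ℂ) * (γ q₂ : ℂ) *
          (((Nat.totient q₂ : ℂ))⁻¹ *
            ∑ χ₂ ∈ (univ.filter fun χ : DirichletCharacter ℂ q₂ => (χ.conductor : ℝ) ≤ R),
              ∑ n₁ ∈ 𝒩.filter (fun n : ℕ => IsCoprime (n : ℤ) a₂),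
                ∑ n₂ ∈ 𝒩.filter (fun n : ℕ => IsCoprime (n : ℤ) a₂),
                  β n₁ * starRingEnd ℂ (β n₂) *
                    χ₂ ((n₂ : ZMod q₂) * ((a₁ : ZMod q₂))⁻¹ * (a₂ : ZMod q₂)) *
                    ∑ m ∈ ℳ, (w m : ℂ) *
                      (if (m : ZMod q₁) * ((n₁ : ZMod q₁) * ((a₁ : ZMod q₁))⁻¹ * (a₂ : ZMod q₁)) = 1
                        then χ₂ (m : ZMod q₂) else 0)) := by
  unfold dispS2
  refine Finset.sum_congr rfl fun q₁ _ => Finset.sum_congr rfl fun q₂ _ => ?_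
  congr 1
  simp only [sum_mul_ite_mul_conj_mainKernel_eq]
  rw [sum_sum_mul_mul_sum]
  refine congrArg _ (Finset.sum_congr rfl fun χ₂ _ => Finset.sum_congr rfl fun n₁ _ =>
    Finset.sum_congr rfl fun n₂ _ => ?_)
  ring

/-! ### The class sums against the twisted values -/

/-- **The class-sum identity of §5.3.2 for the twisted values**: for `q₁, q₂ ∣ W`, `(qⱼ,a₁a₂)=1`,
`(n₁,q₁) = (n₂,q₂) = 1` and `nⱼ' = nⱼ ā₁ a₂ mod qⱼ`,
`∑_{χ₂ ∈ 𝒳_{q₂}(R)} χ₂(n₂') ∑_{b mod W, (b,W)=1, b n₁' ≡ 1 (q₁)} χ₂(b)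
  = (φ(W)/φ(q₁)) ∑_{χ₀ ∈ 𝒳_{(q₁,q₂)}(R)} χ₀(n₁ n̄₂)`
(printed with `χ₀(n̄₁n₂)`, the same sum; the factors `ā₁a₂` cancel).
[cite: Drappeau2017, §5.3.2 (5.19)] -/
theorem sum_twist_mul_sum_units_filter_eq {q₁ q₂ W : ℕ} [NeZero W] (h₁ : q₁ ∣ W) (h₂ : q₂ ∣ W)
    (R : ℝ) {a₁ a₂ : ℤ} (ha₁ : IsCoprime (q₁ : ℤ) (a₁ * a₂)) (ha₂ : IsCoprime (q₂ : ℤ) (a₁ * a₂))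
    {n₁ n₂ : ℕ} (hn₁ : n₁.Coprime q₁) (hn₂ : n₂.Coprime q₂) :
    ∑ χ₂ ∈ (univ.filter fun χ : DirichletCharacter ℂ q₂ => (χ.conductor : ℝ) ≤ R),
      χ₂ ((n₂ : ZMod q₂) * ((a₁ : ZMod q₂))⁻¹ * (a₂ : ZMod q₂)) *
        ∑ b ∈ (univ : Finset (ZMod W)ˣ).filter (fun b : (ZMod W)ˣ =>
            ((b : ZMod W).cast : ZMod q₁) * ((n₁ : ZMod q₁) * ((a₁ : ZMod q₁))⁻¹ * (a₂ : ZMod q₁)) = 1),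
          χ₂ ((b : ZMod W).cast : ZMod q₂) =
      (Nat.totient W : ℂ) / (Nat.totient q₁ : ℂ) *
        ∑ χ₀ ∈ (univ.filter fun χ : DirichletCharacter ℂ (Nat.gcd q₁ q₂) =>
            (χ.conductor : ℝ) ≤ R),
          χ₀ ((n₁ : ZMod (Nat.gcd q₁ q₂)) * ((n₂ : ZMod (Nat.gcd q₁ q₂)))⁻¹) := by
  classical
  haveI hq₁ : NeZero q₁ := ⟨fun h => NeZero.ne W (Nat.eq_zero_of_zero_dvd (h ▸ h₁))⟩
  set g := Nat.gcd q₁ q₂ with hg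
  -- integer representatives
  obtain ⟨u, hu⟩ := exists_int_inv_of_isCoprime ha₁ ha₂
  rw [twist_eq_intCast hu (dvd_mul_left q₂ q₁)]
  simp only [twist_eq_intCast hu (dvd_mul_right q₁ q₂)]
  have huq₁ : IsCoprime u q₁ :=
    isCoprime_of_dvd_mul_sub_one ((Int.dvd_mul_right (q₁ : ℤ) q₂).trans hu)
  have huq₂ : IsCoprime u q₂ :=
    isCoprime_of_dvd_mul_sub_one ((Int.dvd_mul_left (q₁ : ℤ) q₂).trans hu)
  have ha₂q₁ : IsCoprime a₂ q₁ := ha₁.of_mul_right_right.symm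
  have ha₂q₂ : IsCoprime a₂ q₂ := ha₂.of_mul_right_right.symm
  have hM₁ : IsCoprime (n₁ * u * a₂ : ℤ) q₁ :=
    ((Nat.isCoprime_iff_coprime.2 hn₁).mul_left huq₁).mul_left ha₂q₁
  have hM₂ : IsCoprime (n₂ * u * a₂ : ℤ) q₂ :=
    ((Nat.isCoprime_iff_coprime.2 hn₂).mul_left huq₂).mul_left ha₂q₂
  -- an integer inverse `v` of `M₁ = n₁ u a₂` modulo `q₁`
  have hM₁u : IsUnit (((n₁ * u * a₂ : ℤ)) : ZMod q₁) :=
    (ZMod.coe_int_isUnit_iff_isCoprime _ q₁).2 hM₁.symm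
  obtain ⟨v, k, hvk⟩ := hM₁
  have hv : (q₁ : ℤ) ∣ (n₁ * u * a₂) * v - 1 := ⟨-k, by linear_combination hvk⟩
  have hvq₁ : IsCoprime v q₁ := isCoprime_of_dvd_mul_sub_one hv
  -- the class `b M₁ ≡ 1` is the class `b ≡ v`
  have hfilter : (univ : Finset (ZMod W)ˣ).filter (fun b : (ZMod W)ˣ =>
      ((b : ZMod W).cast : ZMod q₁) * (((n₁ * u * a₂ : ℤ)) : ZMod q₁) = 1) =
      (univ : Finset (ZMod W)ˣ).filter
        (fun b : (ZMod W)ˣ => ((b : ZMod W).cast : ZMod q₁) = ((v : ℤ) : ZMod q₁)) := by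
    refine Finset.filter_congr fun b _ => ?_
    obtain ⟨μ, hμ⟩ := hM₁u
    rw [← inv_intCast_eq_of_dvd hv, ← hμ, Units.mul_eq_one_iff_eq_inv, ZMod.inv_coe_unit]
  simp only [hfilter]
  rw [sum_mul_sum_units_filter_eq h₁ h₂ R hvq₁ hM₂]
  congr 1
  -- `χ₀(v) χ₀(M₂) = χ₀(n̄₁ n₂)`, then `t ↦ t̄`
  have hn₁u : IsUnit (n₁ : ZMod g) :=
    (ZMod.isUnit_iff_coprime n₁ g).2 (hn₁.coprime_dvd_right (Nat.gcd_dvd_left q₁ q₂))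
  have hn₂u : IsUnit (n₂ : ZMod g) :=
    (ZMod.isUnit_iff_coprime n₂ g).2 (hn₂.coprime_dvd_right (Nat.gcd_dvd_right q₁ q₂))
  have ht : IsUnit (((u * a₂ : ℤ)) : ZMod g) :=
    (ZMod.coe_int_isUnit_iff_isCoprime _ g).2
      ((huq₁.mul_left ha₂q₁).symm.of_isCoprime_of_dvd_left
        (Int.natCast_dvd_natCast.2 (Nat.gcd_dvd_left q₁ q₂)))
  have hgv : (((n₁ * u * a₂ : ℤ)) : ZMod g) * (v : ZMod g) = 1 := by
    have hgd : (g : ℤ) ∣ (n₁ * u * a₂) * v - 1 :=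
      (Int.natCast_dvd_natCast.2 (Nat.gcd_dvd_left q₁ q₂)).trans hv
    have h0 : (((n₁ * u * a₂) * v - 1 : ℤ) : ZMod g) = 0 :=
      (ZMod.intCast_zmod_eq_zero_iff_dvd _ _).2 hgd
    push_cast at h0 ⊢
    linear_combination h0
  have hval : ∀ χ₀ : DirichletCharacter ℂ g,
      χ₀ (v : ZMod g) * χ₀ (((n₂ * u * a₂ : ℤ)) : ZMod g) =
        χ₀ (((n₁ : ZMod g))⁻¹ * (n₂ : ZMod g)) := by
    intro χ₀
    have hχt : χ₀ (((u * a₂ : ℤ)) : ZMod g) ≠ 0 := fun h0 => by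
      have := ht.map χ₀; rw [h0] at this; exact not_isUnit_zero this
    have hχn₁ : χ₀ (n₁ : ZMod g) ≠ 0 := fun h0 => by
      have := hn₁u.map χ₀; rw [h0] at this; exact not_isUnit_zero this
    have hvinv : χ₀ (v : ZMod g) = (χ₀ (((n₁ * u * a₂ : ℤ)) : ZMod g))⁻¹ := by
      refine (inv_eq_of_mul_eq_one_right ?_).symm
      rw [← map_mul, hgv, map_one]
    have e₁ : ((n₁ * u * a₂ : ℤ) : ZMod g) = (n₁ : ZMod g) * (((u * a₂ : ℤ)) : ZMod g) := by
      push_cast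
      ring
    have e₂ : ((n₂ * u * a₂ : ℤ) : ZMod g) = (n₂ : ZMod g) * (((u * a₂ : ℤ)) : ZMod g) := by
      push_cast
      ring
    rw [hvinv, e₁, e₂, map_mul, map_mul, map_mul, apply_inv_of_isUnit χ₀ hn₁u]
    field_simp
  rw [Finset.sum_congr rfl fun χ₀ _ => hval χ₀, ← inv_inv_mul_eq_mul_inv hn₁u hn₂u]
  exact (sum_filter_conductor_apply_inv_eq R (isUnit_inv_mul hn₁u hn₂u)).symm

/-- The complete sum of `b ↦ 1[b n₁' ≡ 1 (q₁)] χ₂(b)` over `0 ≤ b < [q₁,q₂]` is the class sum over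
the units `mod [q₁,q₂]` (the other terms vanish). [folklore] -/
theorem sum_range_lcm_ite_eq_sum_units_filter {q₁ q₂ : ℕ} [NeZero (Nat.lcm q₁ q₂)]
    (N₁ : ZMod q₁) (χ₂ : DirichletCharacter ℂ q₂) :
    ∑ j ∈ Finset.range (Nat.lcm q₁ q₂),
        (if (j : ZMod q₁) * N₁ = 1 then χ₂ (j : ZMod q₂) else 0) =
      ∑ b ∈ (univ : Finset (ZMod (Nat.lcm q₁ q₂))ˣ).filter
          (fun b : (ZMod (Nat.lcm q₁ q₂))ˣ => ((b : ZMod (Nat.lcm q₁ q₂)).cast : ZMod q₁) * N₁ = 1),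
        χ₂ ((b : ZMod (Nat.lcm q₁ q₂)).cast : ZMod q₂) := by
  have h₁ : q₁ ∣ Nat.lcm q₁ q₂ := Nat.dvd_lcm_left q₁ q₂
  have h₂ : q₂ ∣ Nat.lcm q₁ q₂ := Nat.dvd_lcm_right q₁ q₂
  rw [Finset.sum_filter, MontgomeryVaughan1975.sum_units_eq_sum
    (fun x : ZMod (Nat.lcm q₁ q₂) =>
      if (x.cast : ZMod q₁) * N₁ = 1 then χ₂ (x.cast : ZMod q₂) else 0) ?_]
  · rw [← MontgomeryVaughan1975.sum_range_eq_sum_zmod]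
    refine Finset.sum_congr rfl fun j _ => ?_
    rw [ZMod.cast_natCast h₁, ZMod.cast_natCast h₂]
  · intro x hx
    have hxv : ((x.val : ℕ) : ZMod (Nat.lcm q₁ q₂)) = x := ZMod.natCast_zmod_val x
    have hncop : ¬ (x.val).Coprime (Nat.lcm q₁ q₂) := fun h =>
      hx (hxv ▸ (ZMod.isUnit_iff_coprime _ _).2 h)
    rw [← hxv, ZMod.cast_natCast h₁, ZMod.cast_natCast h₂]
    by_cases hc₁ : (x.val).Coprime q₁
    · have hc₂ : ¬ (x.val).Coprime q₂ := fun hc₂ =>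
        hncop ((Nat.Coprime.mul_right hc₁ hc₂).coprime_dvd_right (Nat.lcm_dvd_mul q₁ q₂))
      rw [MulChar.map_nonunit χ₂ (fun hu => hc₂ ((ZMod.isUnit_iff_coprime _ _).1 hu)), ite_self]
    · rw [if_neg]
      intro h1
      exact hc₁ ((ZMod.isUnit_iff_coprime _ _).1 (isUnit_of_mul_isUnit_left (h1 ▸ isUnit_one)))

/-- **`A · X₃` over the characters of `𝒮₂`** (`X₂ = X₃`: (5.19) and the class-sum identity read
backwards): for positive moduli and any `A`,
`A X₃ = ∑_{q₁,q₂} γ(q₁)γ(q₂) φ(q₂)⁻¹ ∑_{χ₂ ∈ 𝒳_{q₂}(R)} ∑_{n₁,n₂} β_{n₁}β̄_{n₂} χ₂(n₂ā₁a₂)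
        · (A/W) ∑_{0 ≤ b < W, b n₁ā₁a₂ ≡ 1 (q₁)} χ₂(b)`, `W = [q₁,q₂]`.
[cite: Drappeau2017, §5.3.2 (5.19)] -/
theorem mul_mainX3_eq_sum_chars₂ (R : ℝ) (a₁ a₂ : ℤ) {𝒬 : Finset ℕ} (h𝒬 : ∀ q ∈ 𝒬, 0 < q)
    (𝒩 : Finset ℕ) (γ : ℕ → ℝ) (β : ℕ → ℂ) (A : ℂ) :
    A * mainX3 R a₁ a₂ 𝒬 𝒩 γ β =
      ∑ q₁ ∈ 𝒬.filter (fun q : ℕ => IsCoprime (q : ℤ) (a₁ * a₂)),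
        ∑ q₂ ∈ 𝒬.filter (fun q : ℕ => IsCoprime (q : ℤ) (a₁ * a₂)), (γ q₁ : ℂ) * (γ q₂ : ℂ) *
          (((Nat.totient q₂ : ℂ))⁻¹ *
            ∑ χ₂ ∈ (univ.filter fun χ : DirichletCharacter ℂ q₂ => (χ.conductor : ℝ) ≤ R),
              ∑ n₁ ∈ 𝒩.filter (fun n : ℕ => IsCoprime (n : ℤ) a₂),
                ∑ n₂ ∈ 𝒩.filter (fun n : ℕ => IsCoprime (n : ℤ) a₂),
                  β n₁ * starRingEnd ℂ (β n₂) *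
                    χ₂ ((n₂ : ZMod q₂) * ((a₁ : ZMod q₂))⁻¹ * (a₂ : ZMod q₂)) *
                    (A / (Nat.lcm q₁ q₂ : ℂ) *
                      ∑ j ∈ Finset.range (Nat.lcm q₁ q₂),
                        (if (j : ZMod q₁) * ((n₁ : ZMod q₁) * ((a₁ : ZMod q₁))⁻¹ * (a₂ : ZMod q₁)) = 1
                          then χ₂ (j : ZMod q₂) else 0))) := by
  classical
  unfold mainX3
  rw [Finset.mul_sum]
  refine Finset.sum_congr rfl fun q₁ hq₁ => ?_
  rw [Finset.mul_sum]
  refine Finset.sum_congr rfl fun q₂ hq₂ => ?_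
  obtain ⟨hq₁𝒬, hcop₁⟩ := Finset.mem_filter.1 hq₁
  obtain ⟨hq₂𝒬, hcop₂⟩ := Finset.mem_filter.1 hq₂
  have hq₁0 : 0 < q₁ := h𝒬 q₁ hq₁𝒬
  have hq₂0 : 0 < q₂ := h𝒬 q₂ hq₂𝒬
  haveI : NeZero (Nat.lcm q₁ q₂) := ⟨Nat.lcm_ne_zero hq₁0.ne' hq₂0.ne'⟩
  haveI : NeZero q₁ := ⟨hq₁0.ne'⟩
  -- pull `A/W` out, convert the complete sums to class sums over the units
  have hpull : ∀ X Y S : ℂ, X * Y * (A / (Nat.lcm q₁ q₂ : ℂ) * S) =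
      A / (Nat.lcm q₁ q₂ : ℂ) * (X * (Y * S)) := by
    intros
    ring
  simp only [hpull]
  simp only [← Finset.mul_sum, sum_range_lcm_ite_eq_sum_units_filter]
  set L := Nat.lcm q₁ q₂ with hL
  set g := Nat.gcd q₁ q₂ with hg
  set 𝒩' := 𝒩.filter (fun n : ℕ => IsCoprime (n : ℤ) a₂) with h𝒩'
  set 𝒳₂ := (univ.filter fun χ : DirichletCharacter ℂ q₂ => (χ.conductor : ℝ) ≤ R) with h𝒳₂
  set 𝒳₀ := (univ.filter fun χ : DirichletCharacter ℂ g => (χ.conductor : ℝ) ≤ R) with h𝒳₀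
  -- move `(n₁, n₂)` outside and evaluate the character sums
  have hval : ∀ n₁ n₂ : ℕ, ∑ χ₂ ∈ 𝒳₂,
      χ₂ ((n₂ : ZMod q₂) * ((a₁ : ZMod q₂))⁻¹ * (a₂ : ZMod q₂)) *
        ∑ b ∈ (univ : Finset (ZMod L)ˣ).filter (fun b : (ZMod L)ˣ =>
            ((b : ZMod L).cast : ZMod q₁) *
              ((n₁ : ZMod q₁) * ((a₁ : ZMod q₁))⁻¹ * (a₂ : ZMod q₁)) = 1),
          χ₂ ((b : ZMod L).cast : ZMod q₂) =
      if n₁.Coprime q₁ ∧ n₂.Coprime q₂ then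
        (Nat.totient L : ℂ) / (Nat.totient q₁ : ℂ) * ∑ χ₀ ∈ 𝒳₀, χ₀ ((n₁ : ZMod g) * ((n₂ : ZMod g))⁻¹)
      else 0 := by
    intro n₁ n₂
    split_ifs with hcop
    · exact sum_twist_mul_sum_units_filter_eq (Nat.dvd_lcm_left q₁ q₂) (Nat.dvd_lcm_right q₁ q₂)
        R hcop₁ hcop₂ hcop.1 hcop.2
    · rcases not_and_or.1 hcop with hn | hn
      · -- the class `b n₁' ≡ 1 (q₁)` is empty
        refine Finset.sum_eq_zero fun χ₂ _ => ?_
        rw [Finset.sum_eq_zero fun b hb => ?_, mul_zero]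
        exfalso
        have hb1 := (Finset.mem_filter.1 hb).2
        apply hn
        have hu : IsUnit ((n₁ : ZMod q₁) * ((a₁ : ZMod q₁))⁻¹ * (a₂ : ZMod q₁)) :=
          isUnit_of_mul_isUnit_right (hb1 ▸ isUnit_one)
        exact (ZMod.isUnit_iff_coprime n₁ q₁).1
          (isUnit_of_mul_isUnit_left (isUnit_of_mul_isUnit_left hu))
      · refine Finset.sum_eq_zero fun χ₂ _ => ?_
        rw [MulChar.map_nonunit χ₂ ?_, zero_mul]
        intro hu
        exact hn ((ZMod.isUnit_iff_coprime n₂ q₂).1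
          (isUnit_of_mul_isUnit_left (isUnit_of_mul_isUnit_left hu)))
  have hswap : ∑ χ₂ ∈ 𝒳₂, ∑ n₁ ∈ 𝒩', ∑ n₂ ∈ 𝒩', β n₁ * starRingEnd ℂ (β n₂) *
      (χ₂ ((n₂ : ZMod q₂) * ((a₁ : ZMod q₂))⁻¹ * (a₂ : ZMod q₂)) *
        ∑ b ∈ (univ : Finset (ZMod L)ˣ).filter (fun b : (ZMod L)ˣ =>
            ((b : ZMod L).cast : ZMod q₁) *
              ((n₁ : ZMod q₁) * ((a₁ : ZMod q₁))⁻¹ * (a₂ : ZMod q₁)) = 1),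
          χ₂ ((b : ZMod L).cast : ZMod q₂)) =
      ∑ n₁ ∈ 𝒩', ∑ n₂ ∈ 𝒩', β n₁ * starRingEnd ℂ (β n₂) *
        (if n₁.Coprime q₁ ∧ n₂.Coprime q₂ then
          (Nat.totient L : ℂ) / (Nat.totient q₁ : ℂ) *
            ∑ χ₀ ∈ 𝒳₀, χ₀ ((n₁ : ZMod g) * ((n₂ : ZMod g))⁻¹) else 0) := by
    rw [Finset.sum_comm]
    refine Finset.sum_congr rfl fun n₁ _ => ?_
    rw [Finset.sum_comm]
    refine Finset.sum_congr rfl fun n₂ _ => ?_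
    rw [← Finset.mul_sum, hval]
  rw [hswap]
  -- resum over the coprime `nⱼ` and compare the weights
  have hR : ∑ n₁ ∈ 𝒩', ∑ n₂ ∈ 𝒩', β n₁ * starRingEnd ℂ (β n₂) *
      (if n₁.Coprime q₁ ∧ n₂.Coprime q₂ then
        (Nat.totient L : ℂ) / (Nat.totient q₁ : ℂ) *
          ∑ χ₀ ∈ 𝒳₀, χ₀ ((n₁ : ZMod g) * ((n₂ : ZMod g))⁻¹) else 0) =
      (Nat.totient L : ℂ) / (Nat.totient q₁ : ℂ) *
        ∑ χ₀ ∈ 𝒳₀, ∑ n₁ ∈ 𝒩'.filter (fun n => n.Coprime q₁),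
          ∑ n₂ ∈ 𝒩'.filter (fun n => n.Coprime q₂),
            β n₁ * starRingEnd ℂ (β n₂) * χ₀ ((n₁ : ZMod g) * ((n₂ : ZMod g))⁻¹) := by
    rw [Finset.sum_comm (s := 𝒳₀) (t := 𝒩'.filter (fun n => n.Coprime q₁)), Finset.mul_sum,
      Finset.sum_filter (fun n : ℕ => n.Coprime q₁)]
    refine Finset.sum_congr rfl fun n₁ _ => ?_
    split_ifs with hP₁
    · rw [Finset.sum_comm (s := 𝒳₀) (t := 𝒩'.filter (fun n => n.Coprime q₂)), Finset.mul_sum,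
        Finset.sum_filter (fun n : ℕ => n.Coprime q₂)]
      refine Finset.sum_congr rfl fun n₂ _ => ?_
      by_cases hP₂ : n₂.Coprime q₂
      · rw [if_pos ⟨hP₁, hP₂⟩, if_pos hP₂, Finset.mul_sum, Finset.mul_sum, Finset.mul_sum]
        refine Finset.sum_congr rfl fun χ₀ _ => ?_
        ring
      · rw [if_neg (fun h => hP₂ h.2), if_neg hP₂, mul_zero]
    · refine Finset.sum_eq_zero fun n₂ _ => ?_
      rw [if_neg (fun h => hP₁ h.1), mul_zero]
  rw [hR]
  have hφ : ((Nat.totient q₁ : ℂ)) * (Nat.totient q₂ : ℂ) =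
      (Nat.totient L : ℂ) * (Nat.totient g : ℂ) := by
    exact_mod_cast (totient_lcm_mul_totient_gcd q₁ q₂).symm
  have hφ₁ : (Nat.totient q₁ : ℂ) ≠ 0 := by exact_mod_cast (Nat.totient_pos.2 hq₁0).ne'
  have hφ₂ : (Nat.totient q₂ : ℂ) ≠ 0 := by exact_mod_cast (Nat.totient_pos.2 hq₂0).ne'
  have hφg : (Nat.totient g : ℂ) ≠ 0 := by
    exact_mod_cast (Nat.totient_pos.2 (Nat.gcd_pos_of_pos_left q₂ hq₁0)).ne'
  have hL0 : (L : ℂ) ≠ 0 := by exact_mod_cast (Nat.lcm_pos hq₁0 hq₂0).ne'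
  have hφL : (Nat.totient L : ℂ) = (Nat.totient q₁ : ℂ) * (Nat.totient q₂ : ℂ) / (Nat.totient g : ℂ) := by
    rw [hφ, mul_div_cancel_right₀ _ hφg]
  rw [hφL]
  push_cast
  field_simp

/-- **`𝒮₂ − A X₃` over the characters**: with
`E(χ₂; n₁) := ∑_{m: mn₁'≡1 (q₁)} w(m)χ₂(m) − (A/W) ∑_{0 ≤ b < W, bn₁'≡1 (q₁)} χ₂(b)` (`W = [q₁,q₂]`;
the quantity (5.18) estimates),
`𝒮₂ − A X₃ = ∑_{q₁,q₂} γ(q₁)γ(q₂) φ(q₂)⁻¹ ∑_{χ₂} ∑_{n₁,n₂} β_{n₁}β̄_{n₂} χ₂(n₂') E(χ₂; n₁)`.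
[cite: Drappeau2017, §5.3.2 (5.17)–(5.19)] -/
theorem dispS2_sub_mul_mainX3_eq (R : ℝ) (a₁ a₂ : ℤ) {𝒬 : Finset ℕ} (h𝒬 : ∀ q ∈ 𝒬, 0 < q)
    (ℳ 𝒩 : Finset ℕ) (γ w : ℕ → ℝ) (β : ℕ → ℂ) (A : ℂ) :
    dispS2 R a₁ a₂ 𝒬 ℳ 𝒩 γ w β - A * mainX3 R a₁ a₂ 𝒬 𝒩 γ β =
      ∑ q₁ ∈ 𝒬.filter (fun q : ℕ => IsCoprime (q : ℤ) (a₁ * a₂)),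
        ∑ q₂ ∈ 𝒬.filter (fun q : ℕ => IsCoprime (q : ℤ) (a₁ * a₂)), (γ q₁ : ℂ) * (γ q₂ : ℂ) *
          (((Nat.totient q₂ : ℂ))⁻¹ *
            ∑ χ₂ ∈ (univ.filter fun χ : DirichletCharacter ℂ q₂ => (χ.conductor : ℝ) ≤ R),
              ∑ n₁ ∈ 𝒩.filter (fun n : ℕ => IsCoprime (n : ℤ) a₂),
                ∑ n₂ ∈ 𝒩.filter (fun n : ℕ => IsCoprime (n : ℤ) a₂),
                  β n₁ * starRingEnd ℂ (β n₂) *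
                    χ₂ ((n₂ : ZMod q₂) * ((a₁ : ZMod q₂))⁻¹ * (a₂ : ZMod q₂)) *
                    (∑ m ∈ ℳ, (w m : ℂ) *
                        (if (m : ZMod q₁) * ((n₁ : ZMod q₁) * ((a₁ : ZMod q₁))⁻¹ * (a₂ : ZMod q₁)) = 1
                          then χ₂ (m : ZMod q₂) else 0) -
                      A / (Nat.lcm q₁ q₂ : ℂ) *
                        ∑ j ∈ Finset.range (Nat.lcm q₁ q₂),
                          (if (j : ZMod q₁) * ((n₁ : ZMod q₁) * ((a₁ : ZMod q₁))⁻¹ * (a₂ : ZMod q₁)) = 1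
                            then χ₂ (j : ZMod q₂) else 0))) := by
  rw [dispS2_eq_sum_chars, mul_mainX3_eq_sum_chars₂ R a₁ a₂ h𝒬]
  simp only [← Finset.sum_sub_distrib, ← mul_sub]

/-- **The reduction of `𝒮₂ = α̂(0)X₂ + [error]`, `X₂ = X₃`, to the Poisson-summation estimate**:
if `|∑_{m: mn₁'≡1 (q₁)} w(m)χ₂(m) − (A/W)∑_{b<W, bn₁'≡1 (q₁)} χ₂(b)| ≤ E` for all `q₁, q₂`, all
`χ₂ ∈ 𝒳_{q₂}(R)` and all `n₁`, then
`|𝒮₂ − A X₃| ≤ ∑_{q₁,q₂} |γ(q₁)γ(q₂)| φ(q₂)⁻¹ #𝒳_{q₂}(R) (∑_n |β_n|)² E`.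
[cite: Drappeau2017, §5.3.2] -/
theorem norm_dispS2_sub_mul_mainX3_le (R : ℝ) (a₁ a₂ : ℤ) {𝒬 : Finset ℕ} (h𝒬 : ∀ q ∈ 𝒬, 0 < q)
    (ℳ 𝒩 : Finset ℕ) (γ w : ℕ → ℝ) (β : ℕ → ℂ) (A : ℂ) {E : ℝ}
    (hE : ∀ q₁ ∈ 𝒬.filter (fun q : ℕ => IsCoprime (q : ℤ) (a₁ * a₂)),
      ∀ q₂ ∈ 𝒬.filter (fun q : ℕ => IsCoprime (q : ℤ) (a₁ * a₂)),
        ∀ χ₂ ∈ (univ.filter fun χ : DirichletCharacter ℂ q₂ => (χ.conductor : ℝ) ≤ R),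
          ∀ n₁ ∈ 𝒩.filter (fun n : ℕ => IsCoprime (n : ℤ) a₂),
            ‖∑ m ∈ ℳ, (w m : ℂ) *
                  (if (m : ZMod q₁) * ((n₁ : ZMod q₁) * ((a₁ : ZMod q₁))⁻¹ * (a₂ : ZMod q₁)) = 1
                    then χ₂ (m : ZMod q₂) else 0) -
                A / (Nat.lcm q₁ q₂ : ℂ) *
                  ∑ j ∈ Finset.range (Nat.lcm q₁ q₂),
                    (if (j : ZMod q₁) * ((n₁ : ZMod q₁) * ((a₁ : ZMod q₁))⁻¹ * (a₂ : ZMod q₁)) = 1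
                      then χ₂ (j : ZMod q₂) else 0)‖ ≤ E) :
    ‖dispS2 R a₁ a₂ 𝒬 ℳ 𝒩 γ w β - A * mainX3 R a₁ a₂ 𝒬 𝒩 γ β‖ ≤
      ∑ q₁ ∈ 𝒬.filter (fun q : ℕ => IsCoprime (q : ℤ) (a₁ * a₂)),
        ∑ q₂ ∈ 𝒬.filter (fun q : ℕ => IsCoprime (q : ℤ) (a₁ * a₂)), |γ q₁ * γ q₂| *
          (((Nat.totient q₂ : ℝ))⁻¹ *
            (((univ.filter fun χ : DirichletCharacter ℂ q₂ => (χ.conductor : ℝ) ≤ R).card : ℝ) *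
              (∑ n ∈ 𝒩.filter (fun n : ℕ => IsCoprime (n : ℤ) a₂), ‖β n‖) ^ 2 * E)) := by
  rw [dispS2_sub_mul_mainX3_eq R a₁ a₂ h𝒬]
  refine (norm_sum_le _ _).trans (Finset.sum_le_sum fun q₁ hq₁ => ?_)
  refine (norm_sum_le _ _).trans (Finset.sum_le_sum fun q₂ hq₂ => ?_)
  set 𝒩' := 𝒩.filter (fun n : ℕ => IsCoprime (n : ℤ) a₂) with h𝒩'
  set 𝒳₂ := (univ.filter fun χ : DirichletCharacter ℂ q₂ => (χ.conductor : ℝ) ≤ R) with h𝒳₂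
  rw [norm_mul, norm_mul, Complex.norm_real, Complex.norm_real, Real.norm_eq_abs,
    Real.norm_eq_abs, ← abs_mul, norm_mul, norm_inv, Complex.norm_natCast]
  refine mul_le_mul_of_nonneg_left (mul_le_mul_of_nonneg_left ?_ (by positivity)) (abs_nonneg _)
  have hinner : ∑ n₁ ∈ 𝒩', ∑ n₂ ∈ 𝒩', ‖β n₁‖ * ‖β n₂‖ * E = (∑ n ∈ 𝒩', ‖β n‖) ^ 2 * E := by
    rw [sq, Finset.sum_mul_sum, Finset.sum_mul]
    refine Finset.sum_congr rfl fun n₁ _ => ?_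
    rw [Finset.sum_mul]
  calc _ ≤ ∑ χ₂ ∈ 𝒳₂, ∑ n₁ ∈ 𝒩', ∑ n₂ ∈ 𝒩', ‖β n₁‖ * ‖β n₂‖ * E := by
        refine (norm_sum_le _ _).trans (Finset.sum_le_sum fun χ₂ hχ₂ => ?_)
        refine (norm_sum_le _ _).trans (Finset.sum_le_sum fun n₁ hn₁ => ?_)
        refine (norm_sum_le _ _).trans (Finset.sum_le_sum fun n₂ _ => ?_)
        have hEχ := hE q₁ hq₁ q₂ hq₂ χ₂ hχ₂ n₁ hn₁
        rw [norm_mul, norm_mul, norm_mul, Complex.norm_conj]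
        calc ‖β n₁‖ * ‖β n₂‖ * _ * _ ≤ ‖β n₁‖ * ‖β n₂‖ * 1 * E :=
              mul_le_mul (mul_le_mul_of_nonneg_left (χ₂.norm_le_one _) (by positivity)) hEχ
                (norm_nonneg _) (by positivity)
          _ = ‖β n₁‖ * ‖β n₂‖ * E := by ring
    _ = _ := by
        simp only [hinner, Finset.sum_const, nsmul_eq_mul]
        ring

end Drappeau2017

end Literature.NumberTheory.Sieve

end
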